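import Literature.Topology.FourManifolds.CappellShanesonSeventysixIntegers
import Literature.Topology.FourManifolds.CappellShanesonClassGroupAux
import Literature.Topology.FourManifolds.CappellShanesonIdealClasses
import HarnessLib

/-!
# The ideal classes of the non-maximal order `ℤ[Θ₇₆]`, I: the principal genus

Iwaki (K. Iwaki, *Non-invertible ideal classes of Cappell–Shaneson polynomial orders*, 2025,
§4.3 Table) lists, for the trace `n = 76` — the one trace in `70 ≤ n ≤ 78` at which
`ℤ[Θₙ] = ℤ[x]/(fₙ)`, `fₙ = x³ - nx² + (n-1)x - 1`, is NOT the maximal order (`Δ(f₇₆) = 7³·17·4999`,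
`[𝓞 K : ℤ[θ]] = 7`, `CappellShanesonSeventysixIntegers.lean`) — an ideal class monoid `C(ℤ[Θ₇₆])`
of `35` classes with representatives `⟨Θ - c, d⟩`.  The class group of the maximal order
`𝓞 K = ℤ ⊕ ℤθ ⊕ ℤη`, `η = (θ - 2)²/7`, is cyclic of order `5`
(`CappellShanesonClassGroupSeventysix{,Rel}.lean`), and the `35` classes are `5` genera (the class
of `J 𝓞 K`) of `7` classes each.  This file treats the PRINCIPAL GENUS: **every non-zero ideal `J` of
`ℤ[Θ₇₆]` with `J 𝓞 K` principal — precisely, `x₀ · φ(J) 𝓞 K = y₀ · 𝓞 K` for the embedding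
`φ : ℤ[Θ₇₆] ↪ 𝓞 K` and some `x₀, y₀ ≠ 0` — satisfies `x J = y ⟨Θ - c, d⟩` with `x, y ≠ 0` for one of
the seven pairs `(c, d) = (1,1), (2,21), (30,47), (90,137), (65,147), (86,147), (128,147)`** of
Iwaki's row `n = 76` (`ideal_class_adjoinRoot_seventysix_principal_of_root`).  The other four genera
are obtained from this one in the sequel by twisting with an invertible ideal of order `5`.

## The proof (the conductor square, as for `n = 27` in `CappellShanesonTwentysevenIdealClasses.lean`)

1. The conductor of `ℤ[θ]` in `𝓞 K` is `𝔠 = 7 𝓞 K + (θ - 2) 𝓞 K = 𝔭𝔮` (`𝔭 = (7, η)`, `𝔮 = (7, η - 3)`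
   the primes above `7 = 𝔭𝔮²`), and `𝔠 = φ(⟨7, Θ - 2⟩) ⊆ φ(ℤ[Θ₇₆])`: `7 · 𝓞 K ⊆ ℤ[θ]`
   (`7η = (θ - 2)²`) and `(θ - 2) · 𝓞 K ⊆ ℤ[θ]` (`(θ - 2)η = 10θ² - 9θ - 1`).
2. Normalise: `N = {n : x₀ φ(j) = y₀ n, j ∈ J} ⊆ 𝓞 K` is a `φ(ℤ[Θ₇₆])`-stable lattice containing
   `𝔠` (as `x₀ φ(J) 𝓞 K = y₀ 𝓞 K`), hence determined by its image `V` in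
   `𝓞 K/𝔠 = 𝓞 K/𝔭 × 𝓞 K/𝔮 ≅ 𝔽₇²` under the residue maps `ψ₁ : θ ↦ 2, η ↦ 0` and `ψ₄ : θ ↦ 2, η ↦ 3`
   (`exists_ringHom_zmod_seven_seventysix`, common kernel `𝔠` by `exists_of_residues_eq_zero_seventysix`);
   `V` is an additive subgroup, and since `N 𝓞 K = 𝓞 K`, `V` lies in neither axis.
3. The subgroups of `𝔽₇²` are `0`, `𝔽₇²`, `{x = 0}` and the lines `{y = σx}`; excluding the axes leaves
   `V = 𝔽₇²` (`N = 𝓞 K`, the class of `⟨Θ - 2, 21⟩ ≅ 𝓞 K`) and the six lines `σ = 1, …, 6`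
   (`N = 𝔠 + ℤ(1 + λη)`, `3λ ≡ σ - 1`; `σ = 1` is `N = φ(ℤ[Θ₇₆])`, the principal class `⟨Θ - 1, 1⟩`;
   `σ = 2, 3, 4, 5, 6` give `⟨Θ-30,47⟩`, `⟨Θ-128,147⟩`, `⟨Θ-90,137⟩`, `⟨Θ-65,147⟩`, `⟨Θ-86,147⟩`).
4. Each of the seven lattices carries an explicit certificate `X · 7N_V = Y · φ(⟨Θ - c, d⟩)`:
   identities in `𝓞 K = ℤ⟨1, θ, η⟩` verified by `linear_combination` modulo `f₇₆(θ) = 0` and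
   `7η = (θ - 2)²`, turned into `7a₀x · J = ay · ⟨Θ - c, d⟩` in `ℤ[Θ₇₆]` by injectivity of `φ`
   (`span_mul_eq_of_certificate_seventysix`, the lemma of the `n = 27` file with a general
   normalisation `x₀, y₀` and a two-generator conductor).

(The certificates were found by exact lattice arithmetic in `ℤ⟨1, θ, η⟩`; only their verification is
part of the proof.  That the seven classes are pairwise distinct is not needed for Kim–Yamada's
Theorem B architecture and is not proved.)  All statements are theorems; no named facts.

## References
* [Iwaki2025] K. Iwaki, 2025, §4.3 (Table, row `n = 76`: `#C(ℤ[θ₇₆]) = 35`), Thm. 3.11, Ex. 3.13.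
* [KimYamada2023] M. H. Kim, S. Yamada, Kyungpook Math. J. 63 (2023), §4.3 Prop. 4.12–4.16 and
  Thm. 4.17 (the method, at `n = 27`), Prop. 2.14.
* [Marcus2018] D. A. Marcus, *Number Fields*, 2nd ed., Ch. 2–3 (orders, conductor, ideals).
-/

noncomputable section

open Polynomial Module NumberField Ideal
open scoped NumberField

namespace Literature.Topology.FourManifolds

open Literature.NumberTheory.NumberFields

/-! ### The additive subgroups of `𝔽₇ × 𝔽₇` -/

/-- The additive subgroups of `ZMod 7 × ZMod 7`: zero, everything, a line `y = σ x`, or the line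
`x = 0` (as in `CappellShanesonTwentysevenIdealClasses.lean`, where the lemma is private). [folklore] -/
private theorem zmod_seven_sq_addSubgroup_cases (V : AddSubgroup (ZMod 7 × ZMod 7)) :
    (∀ v, v ∈ V ↔ v = 0) ∨ (∀ v, v ∈ V) ∨
      (∃ σ : ZMod 7, ∀ v, v ∈ V ↔ v.2 = σ * v.1) ∨ (∀ v, v ∈ V ↔ v.1 = 0) := by
  have hsmul : ∀ (k : ZMod 7) (v : ZMod 7 × ZMod 7), v ∈ V → (k * v.1, k * v.2) ∈ V := by
    intro k v hv
    have h := V.nsmul_mem hv k.val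
    have e : k.val • v = (k * v.1, k * v.2) :=
      Prod.ext (by rw [Prod.smul_fst, nsmul_eq_mul, ZMod.natCast_zmod_val])
        (by rw [Prod.smul_snd, nsmul_eq_mul, ZMod.natCast_zmod_val])
    rwa [e] at h
  have hinv : ∀ a : ZMod 7, a ≠ 0 → ∃ k : ZMod 7, k * a = 1 := by decide
  by_cases h1 : ∃ v ∈ V, v.1 ≠ 0
  · obtain ⟨v, hv, hv1⟩ := h1
    obtain ⟨k, hk⟩ := hinv v.1 hv1
    set σ := k * v.2 with hσ
    have hgen : ((1 : ZMod 7), σ) ∈ V := by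
      have := hsmul k v hv
      rwa [hk] at this
    have hline : ∀ a : ZMod 7, (a, σ * a) ∈ V := fun a => by
      have := hsmul a _ hgen
      rwa [mul_one, mul_comm] at this
    by_cases h2 : ∃ u ∈ V, u.2 ≠ σ * u.1
    · right; left
      obtain ⟨u, hu, hu2⟩ := h2
      have h0e : ((0 : ZMod 7), u.2 - σ * u.1) ∈ V := by
        have := V.sub_mem hu (hline u.1)
        rwa [Prod.mk_sub_mk, sub_self] at this
      obtain ⟨k', hk'⟩ := hinv _ (sub_ne_zero.mpr hu2)
      have h01 : ((0 : ZMod 7), (1 : ZMod 7)) ∈ V := by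
        have := hsmul k' _ h0e
        rwa [mul_zero, hk'] at this
      intro x
      have hx2 := hsmul (x.2 - σ * x.1) _ h01
      rw [mul_zero, mul_one] at hx2
      have := V.add_mem (hline x.1) hx2
      rwa [Prod.mk_add_mk, add_zero, add_sub_cancel] at this
    · right; right; left
      push Not at h2
      refine ⟨σ, fun x => ⟨h2 x, fun hx => ?_⟩⟩
      have := hline x.1
      rwa [← hx] at this
  · push Not at h1
    by_cases h3 : ∃ v ∈ V, v ≠ 0
    · right; right; right
      obtain ⟨v, hv, hv0⟩ := h3
      have hv2 : v.2 ≠ 0 := fun h => hv0 (Prod.ext (h1 v hv) h)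
      obtain ⟨k, hk⟩ := hinv _ hv2
      have h01 : ((0 : ZMod 7), (1 : ZMod 7)) ∈ V := by
        have := hsmul k v hv
        rwa [h1 v hv, mul_zero, hk] at this
      intro x
      refine ⟨h1 x, fun hx => ?_⟩
      have := hsmul x.2 _ h01
      rw [mul_zero, mul_one, ← hx] at this
      exact this
    · left
      push Not at h3
      intro x
      exact ⟨h3 x, fun hx => hx ▸ V.zero_mem⟩

/-! ### From a lattice certificate to an equation of ideal classes -/

/-- **Certificate ⇒ class equation** (the lemma of the `n = 27` file, with a general normalisation).
Let `φ : A → S` be injective, `J ⊆ A` an ideal, `x₀, y₀ ∈ S`, `N = {n : x₀ φ(j) = y₀ n for some j ∈ J}`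
with every `x₀ φ(j)`, `j ∈ J`, of this form, and suppose `N` is generated by `m₁, m₂` over `φ(A)` and
by `m₃, m₄` over `ℤ`.  If `7X mᵢ = Y φ(bᵢ)` with `bᵢ ∈ ⟨g₁, g₂⟩` and `Y φ(gᵢ) = 7X nᵢ` with `nᵢ ∈ N`,
then `7a₀x · J = a y · ⟨g₁, g₂⟩` in `A`, where `φ x = X`, `φ y = Y`, `φ a = 7y₀`, `φ a₀ = 7x₀`. [folklore] -/
private theorem span_mul_eq_of_certificate_seventysix {A S : Type*} [CommRing A] [CommRing S]
    (φ : A →+* S) (hφ : Function.Injective φ) {J : Ideal A} {N : AddSubgroup S}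
    {x₀ y₀ X Y m₁ m₂ m₃ m₄ n₁ n₂ : S} {a a₀ x y g₁ g₂ b₁ b₂ b₃ b₄ : A}
    (hN : ∀ n, n ∈ N ↔ ∃ j ∈ J, x₀ * φ j = y₀ * n) (hJ : ∀ j ∈ J, ∃ n, x₀ * φ j = y₀ * n)
    (ha : φ a = 7 * y₀) (ha₀ : φ a₀ = 7 * x₀) (hx : φ x = X) (hy : φ y = Y)
    (hdec : ∀ n ∈ N, ∃ (r₁ r₂ : A) (k₃ k₄ : ℤ),
      n = φ r₁ * m₁ + φ r₂ * m₂ + k₃ * m₃ + k₄ * m₄)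
    (hb₁ : b₁ ∈ Ideal.span {g₁, g₂}) (hb₂ : b₂ ∈ Ideal.span {g₁, g₂})
    (hb₃ : b₃ ∈ Ideal.span {g₁, g₂}) (hb₄ : b₄ ∈ Ideal.span {g₁, g₂})
    (e₁ : X * (7 * m₁) = Y * φ b₁) (e₂ : X * (7 * m₂) = Y * φ b₂)
    (e₃ : X * (7 * m₃) = Y * φ b₃) (e₄ : X * (7 * m₄) = Y * φ b₄)
    (hn₁ : n₁ ∈ N) (hn₂ : n₂ ∈ N)
    (f₁ : Y * φ g₁ = X * (7 * n₁)) (f₂ : Y * φ g₂ = X * (7 * n₂)) :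
    Ideal.span {7 * a₀ * x} * J = Ideal.span {a * y} * Ideal.span {g₁, g₂} := by
  have hNmul : ∀ (u : A) (n : S), n ∈ N → φ u * n ∈ N := fun u n hn => by
    obtain ⟨j, hj, e⟩ := (hN n).mp hn
    exact (hN _).mpr ⟨u * j, J.mul_mem_left u hj, by rw [map_mul]; linear_combination (φ u) * e⟩
  apply le_antisymm
  · rw [Ideal.mul_le]
    intro z hz j hj
    obtain ⟨z, rfl⟩ := Ideal.mem_span_singleton'.mp hz
    obtain ⟨n, hn⟩ := hJ j hj
    obtain ⟨r₁, r₂, k₃, k₄, rfl⟩ := hdec n ((hN n).mpr ⟨j, hj, hn⟩)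
    have hmem : z * (a * y) * (r₁ * b₁ + r₂ * b₂ + k₃ * b₃ + k₄ * b₄) ∈
        Ideal.span {a * y} * Ideal.span {g₁, g₂} :=
      Ideal.mul_mem_mul (Ideal.mem_span_singleton'.mpr ⟨z, rfl⟩)
        (add_mem (add_mem (add_mem (Ideal.mul_mem_left _ _ hb₁) (Ideal.mul_mem_left _ _ hb₂))
          (Ideal.mul_mem_left _ _ hb₃)) (Ideal.mul_mem_left _ _ hb₄))
    convert hmem using 1
    apply hφ
    simp only [map_mul, map_add, map_intCast, map_ofNat, ha, ha₀, hx, hy]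
    linear_combination (49 * X * φ z) * hn + (7 * y₀ * φ z * φ r₁) * e₁ +
      (7 * y₀ * φ z * φ r₂) * e₂ + (7 * y₀ * φ z * k₃) * e₃ + (7 * y₀ * φ z * k₄) * e₄
  · rw [Ideal.mul_le]
    intro z hz i hi
    obtain ⟨z, rfl⟩ := Ideal.mem_span_singleton'.mp hz
    obtain ⟨u, v, rfl⟩ := Ideal.mem_span_pair.mp hi
    have hn : φ u * n₁ + φ v * n₂ ∈ N := N.add_mem (hNmul u _ hn₁) (hNmul v _ hn₂)
    obtain ⟨j, hj, hjn⟩ := (hN _).mp hn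
    have hmem : z * (7 * a₀ * x) * j ∈ Ideal.span {7 * a₀ * x} * J :=
      Ideal.mul_mem_mul (Ideal.mem_span_singleton'.mpr ⟨z, rfl⟩) hj
    convert hmem using 1
    apply hφ
    simp only [map_mul, map_add, map_ofNat, ha, ha₀, hx, hy]
    linear_combination (7 * y₀ * φ z * φ u) * f₁ + (7 * y₀ * φ z * φ v) * f₂ -
      (49 * X * φ z) * hjn

section Field

variable {K : Type*} [Field K] [NumberField K] {θ : K}

/-! ### The principal genus of `C(ℤ[Θ₇₆])` -/

set_option maxHeartbeats 1600000 in
/-- **The principal genus of the ideal class monoid of `ℤ[Θ₇₆]`** (Iwaki 2025, §4.3 Table, row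
`n = 76`, the seven classes over the trivial class of `Cl(𝓞 K) ≅ ℤ/5`): let `K = ℚ(θ)` be a cubic
field with `f₇₆(θ) = 0`, `φ : ℤ[Θ₇₆] ↪ 𝓞 K` the embedding `Θ₇₆ ↦ θ`, and `J` an ideal of `ℤ[Θ₇₆]`
whose extension is principal in the normalised sense `x₀ · φ(J) 𝓞 K = y₀ · 𝓞 K` (`x₀, y₀ ≠ 0`).
Then `x J = y ⟨Θ₇₆ - c, d⟩` for some non-zero `x, y ∈ ℤ[Θ₇₆]` and one of
`(c, d) = (1,1), (2,21), (30,47), (90,137), (65,147), (86,147), (128,147)`.  Proof by the conductor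
square `𝓞 K/(7, θ - 2) ≅ 𝔽₇²` and seven explicit lattice certificates (module docstring). [cite: Iwaki2025, §4.3 (Table, row n = 76); KimYamada2023, §4.3 Prop. 4.12–4.16 and Thm. 4.17 (the method)] -/
theorem ideal_class_adjoinRoot_seventysix_principal_of_root (hθ : aeval θ (csPoly 76) = 0)
    (h3 : finrank ℚ K = 3) {φ : AdjoinRoot (csPoly 76) →+* 𝓞 K}
    (hφr : φ (csRoot 76) = thetaInt hθ) (hφinj : Function.Injective φ)
    (J : Ideal (AdjoinRoot (csPoly 76))) {x₀ y₀ : 𝓞 K} (hx₀ : x₀ ≠ 0) (hy₀ : y₀ ≠ 0)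
    (hJ : span {x₀} * J.map φ = span {y₀} * ⊤) :
    ∃ x y : AdjoinRoot (csPoly 76), x ≠ 0 ∧ y ≠ 0 ∧
      (span {x} * J = span {y} * csIdeal 1 1 76 ∨ span {x} * J = span {y} * csIdeal 2 21 76 ∨
        span {x} * J = span {y} * csIdeal 30 47 76 ∨ span {x} * J = span {y} * csIdeal 90 137 76 ∨
        span {x} * J = span {y} * csIdeal 65 147 76 ∨ span {x} * J = span {y} * csIdeal 86 147 76 ∨
        span {x} * J = span {y} * csIdeal 128 147 76) := by
  classical
  -- ### the maximal order `ℤ⟨1, θ, η⟩`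
  have rel := thetaInt_rel_seventysix hθ
  have he := seven_mul_etaInt_seventysix hθ
  have hte := thetaInt_mul_etaInt_seventysix hθ
  have hcoords := exists_int_coords_seventysix hθ h3
  obtain ⟨ψ₁, hψ₁t, hψ₁e, -⟩ := exists_ringHom_zmod_seven_seventysix hθ h3 (τ := 1) (Or.inl rfl)
  obtain ⟨ψ₄, hψ₄t, hψ₄e, -⟩ := exists_ringHom_zmod_seven_seventysix hθ h3 (τ := 4) (Or.inr rfl)
  have hψ₁e' : ψ₁ (MonicCubic.thetaInt (aeval_eta_seventysix hθ)) = 0 := by rw [hψ₁e]; decide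
  have hψ₄e' : ψ₄ (MonicCubic.thetaInt (aeval_eta_seventysix hθ)) = 3 := by rw [hψ₄e]; decide
  have hker : ∀ z : 𝓞 K, ψ₁ z = 0 → ψ₄ z = 0 →
      ∃ o₁ o₂ : 𝓞 K, z = 7 * o₁ + (thetaInt hθ - 2) * o₂ := fun z h0 h0' =>
    exists_of_residues_eq_zero_seventysix hθ h3 hψ₁t hψ₁e' hψ₄t hψ₄e' h0 h0'
  set t := thetaInt hθ with htdef
  set e := MonicCubic.thetaInt (aeval_eta_seventysix hθ) with hedef
  have h7 : (7 : 𝓞 K) ≠ 0 := by exact_mod_cast (by norm_num : (7 : ℕ) ≠ 0)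
  have h7A : (7 : AdjoinRoot (csPoly 76)) ≠ 0 := by
    have h := intCast_ne_zero_csRoot 76 (show (7 : ℤ) ≠ 0 by norm_num)
    rwa [Int.cast_ofNat] at h
  -- evaluation of `φ` on normal forms
  have hφc : ∀ p₀ p₁ p₂ : ℤ, φ (p₀ + p₁ * csRoot 76 + p₂ * csRoot 76 ^ 2) =
      p₀ + p₁ * t + p₂ * t ^ 2 := fun p₀ p₁ p₂ => by
    simp only [map_add, map_mul, map_pow, map_intCast, hφr]
  have hφb : ∀ p q r c d : ℤ, φ ((p + q * csRoot 76) * (csRoot 76 - c) + r * d) =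
      (p + q * t) * (t - c) + r * d := fun p q r c d => by
    simp only [map_add, map_sub, map_mul, map_intCast, hφr]
  have hφg : ∀ c : ℤ, φ (csRoot 76 - c) = t - c := fun c => by
    rw [map_sub, map_intCast, hφr]
  -- ### the lattice `N = {n : x₀ φ(j) = y₀ n}`
  set N : AddSubgroup (𝓞 K) :=
    (J.toAddSubgroup.map ((AddMonoidHom.mulLeft x₀).comp φ.toAddMonoidHom)).comap
      (AddMonoidHom.mulLeft y₀) with hNdef
  have hN : ∀ n, n ∈ N ↔ ∃ j ∈ J, x₀ * φ j = y₀ * n := fun n => by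
    simp only [hNdef, AddSubgroup.mem_comap, AddSubgroup.mem_map, AddMonoidHom.coe_comp,
      AddMonoidHom.coe_mulLeft, Function.comp_apply, Submodule.mem_toAddSubgroup,
      RingHom.toAddMonoidHom_eq_coe, AddMonoidHom.coe_coe]
  have hmapJ : ∀ j ∈ J, ∃ n, x₀ * φ j = y₀ * n := fun j hj => by
    have h : x₀ * φ j ∈ span {x₀} * J.map φ :=
      Ideal.mul_mem_mul (Ideal.mem_span_singleton_self x₀) (Ideal.mem_map_of_mem φ hj)
    rw [hJ] at h
    obtain ⟨n, -, hn⟩ := Ideal.mem_span_singleton_mul.mp h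
    exact ⟨n, hn.symm⟩
  obtain ⟨z₀, hz₀, hxz₀⟩ : ∃ z₀ ∈ J.map φ, x₀ * z₀ = y₀ := by
    have h : y₀ ∈ span {y₀} * (⊤ : Ideal (𝓞 K)) := by
      rw [Ideal.mul_top]; exact Ideal.mem_span_singleton_self y₀
    rw [← hJ] at h
    exact Ideal.mem_span_singleton_mul.mp h
  -- ### the conductor: `7 𝓞 K ⊆ φ(ℤ[Θ₇₆])` and `(θ - 2) 𝓞 K ⊆ φ(ℤ[Θ₇₆])`
  have hL7 : ∀ o : 𝓞 K, ∃ r : AdjoinRoot (csPoly 76), φ r = 7 * o := fun o => by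
    obtain ⟨u, v, w, rfl⟩ := hcoords o
    -- `7(u + vθ + wη) = (7u + 4w) + (7v - 4w)θ + wθ²`
    refine ⟨(7 * u + 4 * w : ℤ) + (7 * v - 4 * w : ℤ) * csRoot 76 + w * csRoot 76 ^ 2, ?_⟩
    rw [hφc]
    push_cast
    linear_combination (-(w : 𝓞 K)) * he
  have hLt : ∀ o : 𝓞 K, ∃ r : AdjoinRoot (csPoly 76), φ r = (t - 2) * o := fun o => by
    obtain ⟨u, v, w, rfl⟩ := hcoords o
    -- `(θ - 2)(u + vθ + wη) = (-2u - w) + (u - 2v - 9w)θ + (v + 10w)θ²`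
    refine ⟨(-2 * u - w : ℤ) + (u - 2 * v - 9 * w : ℤ) * csRoot 76 + (v + 10 * w : ℤ) * csRoot 76 ^ 2,
      ?_⟩
    rw [hφc]
    push_cast
    linear_combination (-(w : 𝓞 K)) * hte + (-10 * (w : 𝓞 K)) * he
  have key : ∀ c : 𝓞 K, (∀ o, ∃ r : AdjoinRoot (csPoly 76), φ r = c * o) →
      ∀ z ∈ J.map φ, ∀ o : 𝓞 K, ∃ j ∈ J, φ j = c * o * z := by
    intro c hc z hz
    have hz' : z ∈ Submodule.span (𝓞 K) (⇑φ '' ↑J) := hz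
    refine Submodule.span_induction ?_ ?_ ?_ ?_ hz'
    · rintro _ ⟨j, hj, rfl⟩ o
      obtain ⟨r, hr⟩ := hc o
      exact ⟨r * j, J.mul_mem_left r hj, by rw [map_mul, hr]⟩
    · intro o
      exact ⟨0, J.zero_mem, by simp⟩
    · intro x y _ _ hx hy o
      obtain ⟨j₁, hj₁, e₁⟩ := hx o
      obtain ⟨j₂, hj₂, e₂⟩ := hy o
      exact ⟨j₁ + j₂, J.add_mem hj₁ hj₂, by rw [map_add, e₁, e₂]; ring⟩
    · intro s x _ hx o
      obtain ⟨j, hj, e⟩ := hx (o * s)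
      exact ⟨j, hj, by rw [e, smul_eq_mul]; ring⟩
  have hNc : ∀ c : 𝓞 K, (∀ o, ∃ r : AdjoinRoot (csPoly 76), φ r = c * o) → ∀ o, c * o ∈ N := by
    intro c hc o
    obtain ⟨j, hj, ej⟩ := key c hc z₀ hz₀ o
    exact (hN _).mpr ⟨j, hj, by rw [ej, ← hxz₀]; ring⟩
  have hN7 : ∀ o : 𝓞 K, 7 * o ∈ N := hNc 7 hL7
  have hNt : ∀ o : 𝓞 K, (t - 2) * o ∈ N := hNc (t - 2) hLt
  obtain ⟨a, ha⟩ := hL7 y₀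
  obtain ⟨a₀, ha₀⟩ := hL7 x₀
  have ha0 : a ≠ 0 := by
    rintro rfl
    rw [map_zero] at ha
    exact mul_ne_zero h7 hy₀ ha.symm
  have ha₀0 : a₀ ≠ 0 := by
    rintro rfl
    rw [map_zero] at ha₀
    exact mul_ne_zero h7 hx₀ ha₀.symm
  -- ### the image `V ⊆ 𝔽₇²` of `N` determines `N`
  set V : AddSubgroup (ZMod 7 × ZMod 7) := N.map (ψ₁.prod ψ₄).toAddMonoidHom with hVdef
  have hNV : ∀ n, n ∈ N ↔ (ψ₁ n, ψ₄ n) ∈ V := fun n => by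
    rw [hVdef, AddSubgroup.mem_map]
    constructor
    · exact fun hn => ⟨n, hn, rfl⟩
    · rintro ⟨m, hm, hmn⟩
      have e0 : ψ₁ m = ψ₁ n := congrArg Prod.fst hmn
      have e3 : ψ₄ m = ψ₄ n := congrArg Prod.snd hmn
      obtain ⟨o₁, o₂, ho⟩ := hker (n - m) (by rw [map_sub, e0, sub_self])
        (by rw [map_sub, e3, sub_self])
      have : n = m + (7 * o₁ + (t - 2) * o₂) := by rw [← ho]; ring
      rw [this]
      exact N.add_mem hm (N.add_mem (hN7 o₁) (hNt o₂))
  -- decomposition of the conductor part over `φ(ℤ[Θ₇₆])`: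
  -- `7(u + vθ + wη) + (θ - 2)(u' + v'θ + w'η) = φ(u + 3w' + vΘ)·7 + φ((u' - 2w + 11w') + (v' + w + 10w')Θ)·(θ - 2)`
  have hdec0 : ∀ z : 𝓞 K, ψ₁ z = 0 → ψ₄ z = 0 → ∃ r₁ r₂ : AdjoinRoot (csPoly 76),
      z = φ r₁ * 7 + φ r₂ * (t - 2) := by
    intro z h0 h0'
    obtain ⟨o₁, o₂, rfl⟩ := hker z h0 h0'
    obtain ⟨u₁, v₁, w₁, rfl⟩ := hcoords o₁
    obtain ⟨u₂, v₂, w₂, rfl⟩ := hcoords o₂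
    refine ⟨(u₁ + 3 * w₂ : ℤ) + v₁ * csRoot 76 + (0 : ℤ) * csRoot 76 ^ 2,
      (u₂ - 2 * w₁ + 11 * w₂ : ℤ) + (v₂ + w₁ + 10 * w₂ : ℤ) * csRoot 76 + (0 : ℤ) * csRoot 76 ^ 2, ?_⟩
    rw [hφc, hφc]
    push_cast
    linear_combination (w₂ : 𝓞 K) * hte + ((w₁ : 𝓞 K) + 10 * (w₂ : 𝓞 K)) * he
  -- evaluation of `ψ₁`, `ψ₄` on normal forms, and integer multiples
  have hψ₁c : ∀ u v w : ℤ, ψ₁ (u + v * t + w * e) = u + v * 2 + w * 0 := fun u v w => by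
    simp only [map_add, map_mul, map_intCast, hψ₁t, hψ₁e']
  have hψ₄c : ∀ u v w : ℤ, ψ₄ (u + v * t + w * e) = u + v * 2 + w * 3 := fun u v w => by
    simp only [map_add, map_mul, map_intCast, hψ₄t, hψ₄e']
  have hψ₁k : ∀ (v : ZMod 7) (z : 𝓞 K), ψ₁ (((v.val : ℤ) : 𝓞 K) * z) = v * ψ₁ z := fun v z => by
    rw [map_mul, map_intCast, Int.cast_natCast, ZMod.natCast_zmod_val]
  have hψ₄k : ∀ (v : ZMod 7) (z : 𝓞 K), ψ₄ (((v.val : ℤ) : 𝓞 K) * z) = v * ψ₄ z := fun v z => by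
    rw [map_mul, map_intCast, Int.cast_natCast, ZMod.natCast_zmod_val]
  -- ### `N 𝓞 K = 𝓞 K`: `V` lies in neither axis
  have haxis : ∀ ψ : 𝓞 K →+* ZMod 7, ¬ (∀ n ∈ N, ψ n = 0) := by
    intro ψ hψN
    have hle : span {x₀} * J.map φ ≤ span {y₀} * RingHom.ker ψ := by
      rw [Ideal.span_singleton_mul_le_span_singleton_mul]
      intro z hz
      have hz' : z ∈ Submodule.span (𝓞 K) (⇑φ '' ↑J) := hz
      refine Submodule.span_induction ?_ ?_ ?_ ?_ hz'
      · rintro _ ⟨j, hj, rfl⟩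
        obtain ⟨n, hn⟩ := hmapJ j hj
        exact ⟨n, (RingHom.mem_ker).mpr (hψN n ((hN n).mpr ⟨j, hj, hn⟩)), hn⟩
      · exact ⟨0, Ideal.zero_mem _, by simp⟩
      · rintro x y - - ⟨n₁, hn₁, e₁⟩ ⟨n₂, hn₂, e₂⟩
        exact ⟨n₁ + n₂, Ideal.add_mem _ hn₁ hn₂, by rw [mul_add, e₁, e₂, mul_add]⟩
      · rintro s x - ⟨n, hn, en⟩
        exact ⟨s * n, Ideal.mul_mem_left _ s hn, by rw [smul_eq_mul]; linear_combination s * en⟩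
    rw [hJ, Ideal.span_singleton_mul_right_mono hy₀, top_le_iff] at hle
    have h1 : (1 : 𝓞 K) ∈ RingHom.ker ψ := by rw [hle]; exact Submodule.mem_top
    rw [RingHom.mem_ker, map_one] at h1
    revert h1
    decide
  -- ### the subgroups `V` and their certificates
  rcases zmod_seven_sq_addSubgroup_cases V with hV | hV | ⟨σ, hV⟩ | hV
  · -- `V = 0`: `N ⊆ ker ψ₁`, impossible
    exact absurd (fun n hn => by
      have h := (hV _).mp ((hNV n).mp hn)
      exact (Prod.mk_eq_zero.mp h).1) (haxis ψ₁)
  · -- `V = 𝔽₇²`: `N = 𝓞 K`, the class of `⟨Θ - 2, 21⟩`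
    -- certificate: X = (-t + 2), Y = (7 : 𝓞 K); X · 7N = Y · φ(⟨Θ - 2, 21⟩)
    have hx : φ ((2 : ℤ) + (-1 : ℤ) * csRoot 76 + (0 : ℤ) * csRoot 76 ^ 2) = ((2 : ℤ) + (-1 : ℤ) * t + (0 : ℤ) * e) := by
      rw [hφc]
      push_cast
      ring
    have hX : ((2 : ℤ) + (-1 : ℤ) * t + (0 : ℤ) * e) ≠ 0 := by
      push_cast
      refine ne_zero_of_mul_eq_natCast (70 * t - 7 * e + 77) 147 ?_ (by norm_num)
      push_cast
      refine mul_left_cancel₀ (pow_ne_zero 1 h7) ?_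
      linear_combination (7 * t - 14) * he + (7 : 𝓞 K) * rel
    have hy : φ ((7 : ℤ) + (0 : ℤ) * csRoot 76 + (0 : ℤ) * csRoot 76 ^ 2) = ((7 : ℤ) + (0 : ℤ) * t + (0 : ℤ) * e) := by
      rw [hφc]
      push_cast
      ring
    have hY : ((7 : ℤ) + (0 : ℤ) * t + (0 : ℤ) * e) ≠ 0 := by
      push_cast
      refine ne_zero_of_mul_eq_natCast (49 : 𝓞 K) 343 ?_ (by norm_num)
      push_cast
      ring
    have hdec : ∀ n ∈ N, ∃ (r₁ r₂ : AdjoinRoot (csPoly 76)) (k₃ k₄ : ℤ),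
        n = φ r₁ * 7 + φ r₂ * (t - 2) + k₃ * ((1 : ℤ) + (0 : ℤ) * t + (0 : ℤ) * e) + k₄ * ((0 : ℤ) + (0 : ℤ) * t + (1 : ℤ) * e) := by
      intro n hn
      obtain ⟨r₁, r₂, hr⟩ := hdec0 (n - ((ψ₁ n).val : ℤ) * ((1 : ℤ) + (0 : ℤ) * t + (0 : ℤ) * e) - ((5 * (ψ₄ n - ψ₁ n)).val : ℤ) * ((0 : ℤ) + (0 : ℤ) * t + (1 : ℤ) * e))
        (by
          rw [map_sub, map_sub, hψ₁k, hψ₁k, hψ₁c, hψ₁c]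
          generalize ψ₁ n = u₁
          generalize ψ₄ n = u₄
          revert u₁ u₄
          decide)
        (by
          rw [map_sub, map_sub, hψ₄k, hψ₄k, hψ₄c, hψ₄c]
          generalize ψ₁ n = u₁
          generalize ψ₄ n = u₄
          revert u₁ u₄
          decide)
      exact ⟨r₁, r₂, ((ψ₁ n).val : ℤ), ((5 * (ψ₄ n - ψ₁ n)).val : ℤ), by rw [← hr]; push_cast; ring⟩
    have e1 : ((2 : ℤ) + (-1 : ℤ) * t + (0 : ℤ) * e) * (7 * (7 : 𝓞 K)) =
        ((7 : ℤ) + (0 : ℤ) * t + (0 : ℤ) * e) * φ (((-7 : ℤ) + (0 : ℤ) * csRoot 76) * (csRoot 76 - ((2 : ℤ) : AdjoinRoot (csPoly 76))) + (0 : ℤ) * ((21 : ℤ) : AdjoinRoot (csPoly 76))) := by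
      rw [hφb]
      push_cast
      ring
    have e2 : ((2 : ℤ) + (-1 : ℤ) * t + (0 : ℤ) * e) * (7 * (t - 2)) =
        ((7 : ℤ) + (0 : ℤ) * t + (0 : ℤ) * e) * φ (((2 : ℤ) + (-1 : ℤ) * csRoot 76) * (csRoot 76 - ((2 : ℤ) : AdjoinRoot (csPoly 76))) + (0 : ℤ) * ((21 : ℤ) : AdjoinRoot (csPoly 76))) := by
      rw [hφb]
      push_cast
      ring
    have e3 : ((2 : ℤ) + (-1 : ℤ) * t + (0 : ℤ) * e) * (7 * ((1 : ℤ) + (0 : ℤ) * t + (0 : ℤ) * e)) =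
        ((7 : ℤ) + (0 : ℤ) * t + (0 : ℤ) * e) * φ (((-1 : ℤ) + (0 : ℤ) * csRoot 76) * (csRoot 76 - ((2 : ℤ) : AdjoinRoot (csPoly 76))) + (0 : ℤ) * ((21 : ℤ) : AdjoinRoot (csPoly 76))) := by
      rw [hφb]
      push_cast
      ring
    have e4 : ((2 : ℤ) + (-1 : ℤ) * t + (0 : ℤ) * e) * (7 * ((0 : ℤ) + (0 : ℤ) * t + (1 : ℤ) * e)) =
        ((7 : ℤ) + (0 : ℤ) * t + (0 : ℤ) * e) * φ (((-11 : ℤ) + (-10 : ℤ) * csRoot 76) * (csRoot 76 - ((2 : ℤ) : AdjoinRoot (csPoly 76))) + (-1 : ℤ) * ((21 : ℤ) : AdjoinRoot (csPoly 76))) := by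
      rw [hφb]
      push_cast
      refine mul_left_cancel₀ (pow_ne_zero 1 h7) ?_
      linear_combination (-7 * t + 14) * he + (-7 : 𝓞 K) * rel
    have hn1 : ((-1 : ℤ) + (0 : ℤ) * t + (0 : ℤ) * e) ∈ N := (hNV _).mpr (hV _)
    have f1 : ((7 : ℤ) + (0 : ℤ) * t + (0 : ℤ) * e) * φ (csRoot 76 - ((2 : ℤ) : AdjoinRoot (csPoly 76))) = ((2 : ℤ) + (-1 : ℤ) * t + (0 : ℤ) * e) * (7 * ((-1 : ℤ) + (0 : ℤ) * t + (0 : ℤ) * e)) := by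
      rw [hφg]
      push_cast
      ring
    have hn2 : ((11 : ℤ) + (10 : ℤ) * t + (-1 : ℤ) * e) ∈ N := (hNV _).mpr (hV _)
    have f2 : ((7 : ℤ) + (0 : ℤ) * t + (0 : ℤ) * e) * φ (((21 : ℤ) : AdjoinRoot (csPoly 76))) = ((2 : ℤ) + (-1 : ℤ) * t + (0 : ℤ) * e) * (7 * ((11 : ℤ) + (10 : ℤ) * t + (-1 : ℤ) * e)) := by
      rw [map_intCast]
      push_cast
      refine mul_left_cancel₀ (pow_ne_zero 1 h7) ?_
      linear_combination (-7 * t + 14) * he + (-7 : 𝓞 K) * rel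
    refine ⟨7 * a₀ * ((2 : ℤ) + (-1 : ℤ) * csRoot 76 + (0 : ℤ) * csRoot 76 ^ 2), a * ((7 : ℤ) + (0 : ℤ) * csRoot 76 + (0 : ℤ) * csRoot 76 ^ 2),
        mul_ne_zero (mul_ne_zero h7A ha₀0) fun h => hX (by rw [← hx, h, map_zero]),
        mul_ne_zero ha0 fun h => hY (by rw [← hy, h, map_zero]), Or.inr (Or.inl ?_)⟩
    exact span_mul_eq_of_certificate_seventysix φ hφinj hN hmapJ ha ha₀ hx hy hdec
      (Ideal.mem_span_pair.mpr ⟨_, _, rfl⟩) (Ideal.mem_span_pair.mpr ⟨_, _, rfl⟩)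
      (Ideal.mem_span_pair.mpr ⟨_, _, rfl⟩) (Ideal.mem_span_pair.mpr ⟨_, _, rfl⟩) e1 e2 e3 e4 hn1 hn2 f1 f2
  · have h7cases : ∀ τ : ZMod 7, τ = 0 ∨ τ = 1 ∨ τ = 2 ∨ τ = 3 ∨ τ = 4 ∨ τ = 5 ∨ τ = 6 := by
      decide
    rcases h7cases σ with rfl | rfl | rfl | rfl | rfl | rfl | rfl
    · -- `V = {y = 0}`: `N ⊆ ker ψ₄`, impossible
      exact absurd (fun n hn => by
        have h := (hV _).mp ((hNV n).mp hn)
        dsimp only at h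
        rw [h, zero_mul]) (haxis ψ₄)
    · -- the line `y = 1x`: the class of `⟨Θ - 1, 1⟩`
      -- certificate: X = (-1 : 𝓞 K), Y = (7 : 𝓞 K); X · 7N = Y · φ(⟨Θ - 1, 1⟩)
      have hx : φ ((-1 : ℤ) + (0 : ℤ) * csRoot 76 + (0 : ℤ) * csRoot 76 ^ 2) = ((-1 : ℤ) + (0 : ℤ) * t + (0 : ℤ) * e) := by
        rw [hφc]
        push_cast
        ring
      have hX : ((-1 : ℤ) + (0 : ℤ) * t + (0 : ℤ) * e) ≠ 0 := by
        push_cast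
        refine ne_zero_of_mul_eq_natCast (-1 : 𝓞 K) 1 ?_ (by norm_num)
        push_cast
        ring
      have hy : φ ((7 : ℤ) + (0 : ℤ) * csRoot 76 + (0 : ℤ) * csRoot 76 ^ 2) = ((7 : ℤ) + (0 : ℤ) * t + (0 : ℤ) * e) := by
        rw [hφc]
        push_cast
        ring
      have hY : ((7 : ℤ) + (0 : ℤ) * t + (0 : ℤ) * e) ≠ 0 := by
        push_cast
        refine ne_zero_of_mul_eq_natCast (49 : 𝓞 K) 343 ?_ (by norm_num)
        push_cast
        ring
      have hdec : ∀ n ∈ N, ∃ (r₁ r₂ : AdjoinRoot (csPoly 76)) (k₃ k₄ : ℤ),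
          n = φ r₁ * 7 + φ r₂ * (t - 2) + k₃ * ((1 : ℤ) + (0 : ℤ) * t + (0 : ℤ) * e) + k₄ * ((0 : ℤ) + (0 : ℤ) * t + (0 : ℤ) * e) := by
        intro n hn
        have hv := (hV _).mp ((hNV n).mp hn)
        dsimp only at hv
        obtain ⟨r₁, r₂, hr⟩ := hdec0 (n - ((ψ₁ n).val : ℤ) * ((1 : ℤ) + (0 : ℤ) * t + (0 : ℤ) * e))
          (by
            rw [map_sub, hψ₁k, hψ₁c]
            generalize ψ₁ n = u₁
            revert u₁
            decide)
          (by
            rw [map_sub, hψ₄k, hψ₄c, hv]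
            generalize ψ₁ n = u₁
            revert u₁
            decide)
        exact ⟨r₁, r₂, ((ψ₁ n).val : ℤ), 0, by rw [← hr]; push_cast; ring⟩
      have e1 : ((-1 : ℤ) + (0 : ℤ) * t + (0 : ℤ) * e) * (7 * (7 : 𝓞 K)) =
          ((7 : ℤ) + (0 : ℤ) * t + (0 : ℤ) * e) * φ (((0 : ℤ) + (0 : ℤ) * csRoot 76) * (csRoot 76 - ((1 : ℤ) : AdjoinRoot (csPoly 76))) + (-7 : ℤ) * ((1 : ℤ) : AdjoinRoot (csPoly 76))) := by
        rw [hφb]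
        push_cast
        ring
      have e2 : ((-1 : ℤ) + (0 : ℤ) * t + (0 : ℤ) * e) * (7 * (t - 2)) =
          ((7 : ℤ) + (0 : ℤ) * t + (0 : ℤ) * e) * φ (((-1 : ℤ) + (0 : ℤ) * csRoot 76) * (csRoot 76 - ((1 : ℤ) : AdjoinRoot (csPoly 76))) + (1 : ℤ) * ((1 : ℤ) : AdjoinRoot (csPoly 76))) := by
        rw [hφb]
        push_cast
        ring
      have e3 : ((-1 : ℤ) + (0 : ℤ) * t + (0 : ℤ) * e) * (7 * ((1 : ℤ) + (0 : ℤ) * t + (0 : ℤ) * e)) =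
          ((7 : ℤ) + (0 : ℤ) * t + (0 : ℤ) * e) * φ (((0 : ℤ) + (0 : ℤ) * csRoot 76) * (csRoot 76 - ((1 : ℤ) : AdjoinRoot (csPoly 76))) + (-1 : ℤ) * ((1 : ℤ) : AdjoinRoot (csPoly 76))) := by
        rw [hφb]
        push_cast
        ring
      have e4 : ((-1 : ℤ) + (0 : ℤ) * t + (0 : ℤ) * e) * (7 * ((0 : ℤ) + (0 : ℤ) * t + (0 : ℤ) * e)) =
          ((7 : ℤ) + (0 : ℤ) * t + (0 : ℤ) * e) * φ (((0 : ℤ) + (0 : ℤ) * csRoot 76) * (csRoot 76 - ((1 : ℤ) : AdjoinRoot (csPoly 76))) + (0 : ℤ) * ((1 : ℤ) : AdjoinRoot (csPoly 76))) := by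
        rw [hφb]
        push_cast
        ring
      have hn1 : ((1 : ℤ) + (-1 : ℤ) * t + (0 : ℤ) * e) ∈ N :=
        (hNV _).mpr ((hV _).mpr (by rw [hψ₁c, hψ₄c]; decide))
      have f1 : ((7 : ℤ) + (0 : ℤ) * t + (0 : ℤ) * e) * φ (csRoot 76 - ((1 : ℤ) : AdjoinRoot (csPoly 76))) = ((-1 : ℤ) + (0 : ℤ) * t + (0 : ℤ) * e) * (7 * ((1 : ℤ) + (-1 : ℤ) * t + (0 : ℤ) * e)) := by
        rw [hφg]
        push_cast
        ring
      have hn2 : ((-1 : ℤ) + (0 : ℤ) * t + (0 : ℤ) * e) ∈ N :=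
        (hNV _).mpr ((hV _).mpr (by rw [hψ₁c, hψ₄c]; decide))
      have f2 : ((7 : ℤ) + (0 : ℤ) * t + (0 : ℤ) * e) * φ (((1 : ℤ) : AdjoinRoot (csPoly 76))) = ((-1 : ℤ) + (0 : ℤ) * t + (0 : ℤ) * e) * (7 * ((-1 : ℤ) + (0 : ℤ) * t + (0 : ℤ) * e)) := by
        rw [map_intCast]
        push_cast
        ring
      refine ⟨7 * a₀ * ((-1 : ℤ) + (0 : ℤ) * csRoot 76 + (0 : ℤ) * csRoot 76 ^ 2), a * ((7 : ℤ) + (0 : ℤ) * csRoot 76 + (0 : ℤ) * csRoot 76 ^ 2),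
          mul_ne_zero (mul_ne_zero h7A ha₀0) fun h => hX (by rw [← hx, h, map_zero]),
          mul_ne_zero ha0 fun h => hY (by rw [← hy, h, map_zero]), Or.inl ?_⟩
      exact span_mul_eq_of_certificate_seventysix φ hφinj hN hmapJ ha ha₀ hx hy hdec
        (Ideal.mem_span_pair.mpr ⟨_, _, rfl⟩) (Ideal.mem_span_pair.mpr ⟨_, _, rfl⟩)
        (Ideal.mem_span_pair.mpr ⟨_, _, rfl⟩) (Ideal.mem_span_pair.mpr ⟨_, _, rfl⟩) e1 e2 e3 e4 hn1 hn2 f1 f2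
    · -- the line `y = 2x`: the class of `⟨Θ - 30, 47⟩`
      -- certificate: X = (-16 * t + 14 * e - 7), Y = (-7 * t - 7 * e - 7); X · 7N = Y · φ(⟨Θ - 30, 47⟩)
      have hx : φ ((1 : ℤ) + (-24 : ℤ) * csRoot 76 + (2 : ℤ) * csRoot 76 ^ 2) = ((-7 : ℤ) + (-16 : ℤ) * t + (14 : ℤ) * e) := by
        rw [hφc]
        push_cast
        refine mul_left_cancel₀ (pow_ne_zero 1 h7) ?_
        linear_combination (-14) * he
      have hX : ((-7 : ℤ) + (-16 : ℤ) * t + (14 : ℤ) * e) ≠ 0 := by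
        push_cast
        refine ne_zero_of_mul_eq_natCast (-199604 * t + 19418 * e + 187631) 132399 ?_ (by norm_num)
        push_cast
        refine mul_left_cancel₀ (pow_ne_zero 2 h7) ?_
        linear_combination (271852 * t ^ 2 - 22823416 * t + 1902964 * e + 18523764) * he + (271852 * t - 3250072) * rel
      have hy : φ ((-11 : ℤ) + (-3 : ℤ) * csRoot 76 + (-1 : ℤ) * csRoot 76 ^ 2) = ((-7 : ℤ) + (-7 : ℤ) * t + (-7 : ℤ) * e) := by
        rw [hφc]
        push_cast
        refine mul_left_cancel₀ (pow_ne_zero 1 h7) ?_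
        linear_combination (7) * he
      have hY : ((-7 : ℤ) + (-7 : ℤ) * t + (-7 : ℤ) * e) ≠ 0 := by
        push_cast
        refine ne_zero_of_mul_eq_natCast (22540 * t - 2107 * e - 86632) 966231 ?_ (by norm_num)
        push_cast
        refine mul_left_cancel₀ (pow_ne_zero 2 h7) ?_
        linear_combination (14749 * t ^ 2 - 1060213 * t + 103243 * e + 4407207) * he + (14749 * t + 1715) * rel
      have hdec : ∀ n ∈ N, ∃ (r₁ r₂ : AdjoinRoot (csPoly 76)) (k₃ k₄ : ℤ),
          n = φ r₁ * 7 + φ r₂ * (t - 2) + k₃ * ((1 : ℤ) + (0 : ℤ) * t + (5 : ℤ) * e) + k₄ * ((0 : ℤ) + (0 : ℤ) * t + (0 : ℤ) * e) := by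
        intro n hn
        have hv := (hV _).mp ((hNV n).mp hn)
        dsimp only at hv
        obtain ⟨r₁, r₂, hr⟩ := hdec0 (n - ((ψ₁ n).val : ℤ) * ((1 : ℤ) + (0 : ℤ) * t + (5 : ℤ) * e))
          (by
            rw [map_sub, hψ₁k, hψ₁c]
            generalize ψ₁ n = u₁
            revert u₁
            decide)
          (by
            rw [map_sub, hψ₄k, hψ₄c, hv]
            generalize ψ₁ n = u₁
            revert u₁
            decide)
        exact ⟨r₁, r₂, ((ψ₁ n).val : ℤ), 0, by rw [← hr]; push_cast; ring⟩
      have e1 : ((-7 : ℤ) + (-16 : ℤ) * t + (14 : ℤ) * e) * (7 * (7 : 𝓞 K)) =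
          ((-7 : ℤ) + (-7 : ℤ) * t + (-7 : ℤ) * e) * φ (((44 : ℤ) + (-1 : ℤ) * csRoot 76) * (csRoot 76 - ((30 : ℤ) : AdjoinRoot (csPoly 76))) + (28 : ℤ) * ((47 : ℤ) : AdjoinRoot (csPoly 76))) := by
        rw [hφb]
        push_cast
        refine mul_left_cancel₀ (pow_ne_zero 1 h7) ?_
        linear_combination (-7 * t ^ 2 + 518 * t + 658) * he + (-7 * t - 35) * rel
      have e2 : ((-7 : ℤ) + (-16 : ℤ) * t + (14 : ℤ) * e) * (7 * (t - 2)) =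
          ((-7 : ℤ) + (-7 : ℤ) * t + (-7 : ℤ) * e) * φ (((-11 : ℤ) + (0 : ℤ) * csRoot 76) * (csRoot 76 - ((30 : ℤ) : AdjoinRoot (csPoly 76))) + (-7 : ℤ) * ((47 : ℤ) : AdjoinRoot (csPoly 76))) := by
        rw [hφb]
        push_cast
        refine mul_left_cancel₀ (pow_ne_zero 1 h7) ?_
        linear_combination (21 * t - 189) * he + (21 : 𝓞 K) * rel
      have e3 : ((-7 : ℤ) + (-16 : ℤ) * t + (14 : ℤ) * e) * (7 * ((1 : ℤ) + (0 : ℤ) * t + (5 : ℤ) * e)) =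
          ((-7 : ℤ) + (-7 : ℤ) * t + (-7 : ℤ) * e) * φ (((-213 : ℤ) + (-8 : ℤ) * csRoot 76) * (csRoot 76 - ((30 : ℤ) : AdjoinRoot (csPoly 76))) + (-136 : ℤ) * ((47 : ℤ) : AdjoinRoot (csPoly 76))) := by
        rw [hφb]
        push_cast
        refine mul_left_cancel₀ (pow_ne_zero 2 h7) ?_
        linear_combination (98 * t ^ 2 - 4557 * t + 3430 * e + 833) * he + (98 * t - 245) * rel
      have e4 : ((-7 : ℤ) + (-16 : ℤ) * t + (14 : ℤ) * e) * (7 * ((0 : ℤ) + (0 : ℤ) * t + (0 : ℤ) * e)) =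
          ((-7 : ℤ) + (-7 : ℤ) * t + (-7 : ℤ) * e) * φ (((0 : ℤ) + (0 : ℤ) * csRoot 76) * (csRoot 76 - ((30 : ℤ) : AdjoinRoot (csPoly 76))) + (0 : ℤ) * ((47 : ℤ) : AdjoinRoot (csPoly 76))) := by
        rw [hφb]
        push_cast
        ring
      have hn1 : ((67 : ℤ) + (-72 : ℤ) * t + (7 : ℤ) * e) ∈ N :=
        (hNV _).mpr ((hV _).mpr (by rw [hψ₁c, hψ₄c]; decide))
      have f1 : ((-7 : ℤ) + (-7 : ℤ) * t + (-7 : ℤ) * e) * φ (csRoot 76 - ((30 : ℤ) : AdjoinRoot (csPoly 76))) = ((-7 : ℤ) + (-16 : ℤ) * t + (14 : ℤ) * e) * (7 * ((67 : ℤ) + (-72 : ℤ) * t + (7 : ℤ) * e)) := by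
        rw [hφg]
        push_cast
        refine mul_left_cancel₀ (pow_ne_zero 2 h7) ?_
        linear_combination (-686 * t ^ 2 + 57575 * t - 4802 * e - 44835) * he + (-686 * t + 8183) * rel
      have hn2 : ((-105 : ℤ) + (113 : ℤ) * t + (-11 : ℤ) * e) ∈ N :=
        (hNV _).mpr ((hV _).mpr (by rw [hψ₁c, hψ₄c]; decide))
      have f2 : ((-7 : ℤ) + (-7 : ℤ) * t + (-7 : ℤ) * e) * φ (((47 : ℤ) : AdjoinRoot (csPoly 76))) = ((-7 : ℤ) + (-16 : ℤ) * t + (14 : ℤ) * e) * (7 * ((-105 : ℤ) + (113 : ℤ) * t + (-11 : ℤ) * e)) := by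
        rw [map_intCast]
        push_cast
        refine mul_left_cancel₀ (pow_ne_zero 2 h7) ?_
        linear_combination (1078 * t ^ 2 - 90454 * t + 7546 * e + 70266) * he + (1078 * t - 12838) * rel
      refine ⟨7 * a₀ * ((1 : ℤ) + (-24 : ℤ) * csRoot 76 + (2 : ℤ) * csRoot 76 ^ 2), a * ((-11 : ℤ) + (-3 : ℤ) * csRoot 76 + (-1 : ℤ) * csRoot 76 ^ 2),
          mul_ne_zero (mul_ne_zero h7A ha₀0) fun h => hX (by rw [← hx, h, map_zero]),
          mul_ne_zero ha0 fun h => hY (by rw [← hy, h, map_zero]), Or.inr (Or.inr (Or.inl ?_))⟩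
      exact span_mul_eq_of_certificate_seventysix φ hφinj hN hmapJ ha ha₀ hx hy hdec
        (Ideal.mem_span_pair.mpr ⟨_, _, rfl⟩) (Ideal.mem_span_pair.mpr ⟨_, _, rfl⟩)
        (Ideal.mem_span_pair.mpr ⟨_, _, rfl⟩) (Ideal.mem_span_pair.mpr ⟨_, _, rfl⟩) e1 e2 e3 e4 hn1 hn2 f1 f2
    · -- the line `y = 3x`: the class of `⟨Θ - 128, 147⟩`
      -- certificate: X = (-7 * e), Y = (7 * t - 14); X · 7N = Y · φ(⟨Θ - 128, 147⟩)
      have hx : φ ((-4 : ℤ) + (4 : ℤ) * csRoot 76 + (-1 : ℤ) * csRoot 76 ^ 2) = ((0 : ℤ) + (0 : ℤ) * t + (-7 : ℤ) * e) := by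
        rw [hφc]
        push_cast
        refine mul_left_cancel₀ (pow_ne_zero 1 h7) ?_
        linear_combination (7) * he
      have hX : ((0 : ℤ) + (0 : ℤ) * t + (-7 : ℤ) * e) ≠ 0 := by
        push_cast
        refine ne_zero_of_mul_eq_natCast (-15337 * t + 1519 * e - 6125) 21609 ?_ (by norm_num)
        push_cast
        refine mul_left_cancel₀ (pow_ne_zero 2 h7) ?_
        linear_combination (-10633 * t ^ 2 + 794045 * t - 74431 * e + 257593) * he + (-10633 * t + 28469) * rel
      have hy : φ ((-14 : ℤ) + (7 : ℤ) * csRoot 76 + (0 : ℤ) * csRoot 76 ^ 2) = ((-14 : ℤ) + (7 : ℤ) * t + (0 : ℤ) * e) := by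
        rw [hφc]
        push_cast
        ring
      have hY : ((-14 : ℤ) + (7 : ℤ) * t + (0 : ℤ) * e) ≠ 0 := by
        push_cast
        refine ne_zero_of_mul_eq_natCast (-3430 * t + 343 * e - 3773) 50421 ?_ (by norm_num)
        push_cast
        refine mul_left_cancel₀ (pow_ne_zero 1 h7) ?_
        linear_combination (2401 * t - 4802) * he + (2401 : 𝓞 K) * rel
      have hdec : ∀ n ∈ N, ∃ (r₁ r₂ : AdjoinRoot (csPoly 76)) (k₃ k₄ : ℤ),
          n = φ r₁ * 7 + φ r₂ * (t - 2) + k₃ * ((1 : ℤ) + (0 : ℤ) * t + (3 : ℤ) * e) + k₄ * ((0 : ℤ) + (0 : ℤ) * t + (0 : ℤ) * e) := by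
        intro n hn
        have hv := (hV _).mp ((hNV n).mp hn)
        dsimp only at hv
        obtain ⟨r₁, r₂, hr⟩ := hdec0 (n - ((ψ₁ n).val : ℤ) * ((1 : ℤ) + (0 : ℤ) * t + (3 : ℤ) * e))
          (by
            rw [map_sub, hψ₁k, hψ₁c]
            generalize ψ₁ n = u₁
            revert u₁
            decide)
          (by
            rw [map_sub, hψ₄k, hψ₄c, hv]
            generalize ψ₁ n = u₁
            revert u₁
            decide)
        exact ⟨r₁, r₂, ((ψ₁ n).val : ℤ), 0, by rw [← hr]; push_cast; ring⟩
      have e1 : ((0 : ℤ) + (0 : ℤ) * t + (-7 : ℤ) * e) * (7 * (7 : 𝓞 K)) =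
          ((-14 : ℤ) + (7 : ℤ) * t + (0 : ℤ) * e) * φ (((-7 : ℤ) + (0 : ℤ) * csRoot 76) * (csRoot 76 - ((128 : ℤ) : AdjoinRoot (csPoly 76))) + (-6 : ℤ) * ((147 : ℤ) : AdjoinRoot (csPoly 76))) := by
        rw [hφb]
        push_cast
        refine mul_left_cancel₀ (pow_ne_zero 1 h7) ?_
        linear_combination (-343) * he
      have e2 : ((0 : ℤ) + (0 : ℤ) * t + (-7 : ℤ) * e) * (7 * (t - 2)) =
          ((-14 : ℤ) + (7 : ℤ) * t + (0 : ℤ) * e) * φ (((-124 : ℤ) + (-1 : ℤ) * csRoot 76) * (csRoot 76 - ((128 : ℤ) : AdjoinRoot (csPoly 76))) + (-108 : ℤ) * ((147 : ℤ) : AdjoinRoot (csPoly 76))) := by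
        rw [hφb]
        push_cast
        refine mul_left_cancel₀ (pow_ne_zero 1 h7) ?_
        linear_combination (-49 * t + 98) * he
      have e3 : ((0 : ℤ) + (0 : ℤ) * t + (-7 : ℤ) * e) * (7 * ((1 : ℤ) + (0 : ℤ) * t + (3 : ℤ) * e)) =
          ((-14 : ℤ) + (7 : ℤ) * t + (0 : ℤ) * e) * φ (((-3814 : ℤ) + (-30 : ℤ) * csRoot 76) * (csRoot 76 - ((128 : ℤ) : AdjoinRoot (csPoly 76))) + (-3321 : ℤ) * ((147 : ℤ) : AdjoinRoot (csPoly 76))) := by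
        rw [hφb]
        push_cast
        refine mul_left_cancel₀ (pow_ne_zero 2 h7) ?_
        linear_combination (-147 * t ^ 2 + 588 * t - 1029 * e - 931) * he + (-147 * t + 294) * rel
      have e4 : ((0 : ℤ) + (0 : ℤ) * t + (-7 : ℤ) * e) * (7 * ((0 : ℤ) + (0 : ℤ) * t + (0 : ℤ) * e)) =
          ((-14 : ℤ) + (7 : ℤ) * t + (0 : ℤ) * e) * φ (((0 : ℤ) + (0 : ℤ) * csRoot 76) * (csRoot 76 - ((128 : ℤ) : AdjoinRoot (csPoly 76))) + (0 : ℤ) * ((147 : ℤ) : AdjoinRoot (csPoly 76))) := by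
        rw [hφb]
        push_cast
        ring
      have hn1 : ((-67 : ℤ) + (-60 : ℤ) * t + (6 : ℤ) * e) ∈ N :=
        (hNV _).mpr ((hV _).mpr (by rw [hψ₁c, hψ₄c]; decide))
      have f1 : ((-14 : ℤ) + (7 : ℤ) * t + (0 : ℤ) * e) * φ (csRoot 76 - ((128 : ℤ) : AdjoinRoot (csPoly 76))) = ((0 : ℤ) + (0 : ℤ) * t + (-7 : ℤ) * e) * (7 * ((-67 : ℤ) + (-60 : ℤ) * t + (6 : ℤ) * e)) := by
        rw [hφg]
        push_cast
        refine mul_left_cancel₀ (pow_ne_zero 2 h7) ?_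
        linear_combination (294 * t ^ 2 - 21756 * t + 2058 * e - 21805) * he + (294 * t - 588) * rel
      have hn2 : ((77 : ℤ) + (70 : ℤ) * t + (-7 : ℤ) * e) ∈ N :=
        (hNV _).mpr ((hV _).mpr (by rw [hψ₁c, hψ₄c]; decide))
      have f2 : ((-14 : ℤ) + (7 : ℤ) * t + (0 : ℤ) * e) * φ (((147 : ℤ) : AdjoinRoot (csPoly 76))) = ((0 : ℤ) + (0 : ℤ) * t + (-7 : ℤ) * e) * (7 * ((77 : ℤ) + (70 : ℤ) * t + (-7 : ℤ) * e)) := by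
        rw [map_intCast]
        push_cast
        refine mul_left_cancel₀ (pow_ne_zero 2 h7) ?_
        linear_combination (-343 * t ^ 2 + 25382 * t - 2401 * e + 25039) * he + (-343 * t + 686) * rel
      refine ⟨7 * a₀ * ((-4 : ℤ) + (4 : ℤ) * csRoot 76 + (-1 : ℤ) * csRoot 76 ^ 2), a * ((-14 : ℤ) + (7 : ℤ) * csRoot 76 + (0 : ℤ) * csRoot 76 ^ 2),
          mul_ne_zero (mul_ne_zero h7A ha₀0) fun h => hX (by rw [← hx, h, map_zero]),
          mul_ne_zero ha0 fun h => hY (by rw [← hy, h, map_zero]), Or.inr (Or.inr (Or.inr (Or.inr (Or.inr (Or.inr (?_))))))⟩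
      exact span_mul_eq_of_certificate_seventysix φ hφinj hN hmapJ ha ha₀ hx hy hdec
        (Ideal.mem_span_pair.mpr ⟨_, _, rfl⟩) (Ideal.mem_span_pair.mpr ⟨_, _, rfl⟩)
        (Ideal.mem_span_pair.mpr ⟨_, _, rfl⟩) (Ideal.mem_span_pair.mpr ⟨_, _, rfl⟩) e1 e2 e3 e4 hn1 hn2 f1 f2
    · -- the line `y = 4x`: the class of `⟨Θ - 90, 137⟩`
      -- certificate: X = (-7 * t + 21 * e + 3), Y = (7 * e + 7); X · 7N = Y · φ(⟨Θ - 90, 137⟩)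
      have hx : φ ((15 : ℤ) + (-19 : ℤ) * csRoot 76 + (3 : ℤ) * csRoot 76 ^ 2) = ((3 : ℤ) + (-7 : ℤ) * t + (21 : ℤ) * e) := by
        rw [hφc]
        push_cast
        refine mul_left_cancel₀ (pow_ne_zero 1 h7) ?_
        linear_combination (-21) * he
      have hX : ((3 : ℤ) + (-7 : ℤ) * t + (21 : ℤ) * e) ≠ 0 := by
        push_cast
        refine ne_zero_of_mul_eq_natCast (-237426 * t + 23387 * e + 2728) 187279 ?_ (by norm_num)
        push_cast
        refine mul_left_cancel₀ (pow_ne_zero 2 h7) ?_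
        linear_combination (491127 * t ^ 2 - 38012093 * t + 3437889 * e + 2856651) * he + (491127 * t - 2650949) * rel
      have hy : φ ((11 : ℤ) + (-4 : ℤ) * csRoot 76 + (1 : ℤ) * csRoot 76 ^ 2) = ((7 : ℤ) + (0 : ℤ) * t + (7 : ℤ) * e) := by
        rw [hφc]
        push_cast
        refine mul_left_cancel₀ (pow_ne_zero 1 h7) ?_
        linear_combination (-7) * he
      have hY : ((7 : ℤ) + (0 : ℤ) * t + (7 : ℤ) * e) ≠ 0 := by
        push_cast
        refine ne_zero_of_mul_eq_natCast (15337 * t - 1568 * e + 43512) 468881 ?_ (by norm_num)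
        push_cast
        refine mul_left_cancel₀ (pow_ne_zero 2 h7) ?_
        linear_combination (-10976 * t ^ 2 + 795417 * t - 76832 * e + 2011352) * he + (-10976 * t + 5145) * rel
      have hdec : ∀ n ∈ N, ∃ (r₁ r₂ : AdjoinRoot (csPoly 76)) (k₃ k₄ : ℤ),
          n = φ r₁ * 7 + φ r₂ * (t - 2) + k₃ * ((1 : ℤ) + (0 : ℤ) * t + (1 : ℤ) * e) + k₄ * ((0 : ℤ) + (0 : ℤ) * t + (0 : ℤ) * e) := by
        intro n hn
        have hv := (hV _).mp ((hNV n).mp hn)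
        dsimp only at hv
        obtain ⟨r₁, r₂, hr⟩ := hdec0 (n - ((ψ₁ n).val : ℤ) * ((1 : ℤ) + (0 : ℤ) * t + (1 : ℤ) * e))
          (by
            rw [map_sub, hψ₁k, hψ₁c]
            generalize ψ₁ n = u₁
            revert u₁
            decide)
          (by
            rw [map_sub, hψ₄k, hψ₄c, hv]
            generalize ψ₁ n = u₁
            revert u₁
            decide)
        exact ⟨r₁, r₂, ((ψ₁ n).val : ℤ), 0, by rw [← hr]; push_cast; ring⟩
      have e1 : ((3 : ℤ) + (-7 : ℤ) * t + (21 : ℤ) * e) * (7 * (7 : 𝓞 K)) =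
          ((7 : ℤ) + (0 : ℤ) * t + (7 : ℤ) * e) * φ (((16 : ℤ) + (1 : ℤ) * csRoot 76) * (csRoot 76 - ((90 : ℤ) : AdjoinRoot (csPoly 76))) + (11 : ℤ) * ((137 : ℤ) : AdjoinRoot (csPoly 76))) := by
        rw [hφb]
        push_cast
        refine mul_left_cancel₀ (pow_ne_zero 1 h7) ?_
        linear_combination (-7 * t ^ 2 + 518 * t + 560) * he + (-7 * t + 14) * rel
      have e2 : ((3 : ℤ) + (-7 : ℤ) * t + (21 : ℤ) * e) * (7 * (t - 2)) =
          ((7 : ℤ) + (0 : ℤ) * t + (7 : ℤ) * e) * φ (((20 : ℤ) + (0 : ℤ) * csRoot 76) * (csRoot 76 - ((90 : ℤ) : AdjoinRoot (csPoly 76))) + (13 : ℤ) * ((137 : ℤ) : AdjoinRoot (csPoly 76))) := by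
        rw [hφb]
        push_cast
        refine mul_left_cancel₀ (pow_ne_zero 1 h7) ?_
        linear_combination (7 * t - 161) * he + (7 : 𝓞 K) * rel
      have e3 : ((3 : ℤ) + (-7 : ℤ) * t + (21 : ℤ) * e) * (7 * ((1 : ℤ) + (0 : ℤ) * t + (1 : ℤ) * e)) =
          ((7 : ℤ) + (0 : ℤ) * t + (7 : ℤ) * e) * φ (((251 : ℤ) + (3 : ℤ) * csRoot 76) * (csRoot 76 - ((90 : ℤ) : AdjoinRoot (csPoly 76))) + (165 : ℤ) * ((137 : ℤ) : AdjoinRoot (csPoly 76))) := by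
        rw [hφb]
        push_cast
        refine mul_left_cancel₀ (pow_ne_zero 2 h7) ?_
        linear_combination (1029 * e + 1029) * he
      have e4 : ((3 : ℤ) + (-7 : ℤ) * t + (21 : ℤ) * e) * (7 * ((0 : ℤ) + (0 : ℤ) * t + (0 : ℤ) * e)) =
          ((7 : ℤ) + (0 : ℤ) * t + (7 : ℤ) * e) * φ (((0 : ℤ) + (0 : ℤ) * csRoot 76) * (csRoot 76 - ((90 : ℤ) : AdjoinRoot (csPoly 76))) + (0 : ℤ) * ((137 : ℤ) : AdjoinRoot (csPoly 76))) := by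
        rw [hφb]
        push_cast
        ring
      have hn1 : ((-4 : ℤ) + (132 : ℤ) * t + (-13 : ℤ) * e) ∈ N :=
        (hNV _).mpr ((hV _).mpr (by rw [hψ₁c, hψ₄c]; decide))
      have f1 : ((7 : ℤ) + (0 : ℤ) * t + (7 : ℤ) * e) * φ (csRoot 76 - ((90 : ℤ) : AdjoinRoot (csPoly 76))) = ((3 : ℤ) + (-7 : ℤ) * t + (21 : ℤ) * e) * (7 * ((-4 : ℤ) + (132 : ℤ) * t + (-13 : ℤ) * e)) := by
        rw [hφg]
        push_cast
        refine mul_left_cancel₀ (pow_ne_zero 2 h7) ?_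
        linear_combination (1911 * t ^ 2 - 147882 * t + 13377 * e + 9261) * he + (1911 * t - 10290) * rel
      have hn2 : ((6 : ℤ) + (-203 : ℤ) * t + (20 : ℤ) * e) ∈ N :=
        (hNV _).mpr ((hV _).mpr (by rw [hψ₁c, hψ₄c]; decide))
      have f2 : ((7 : ℤ) + (0 : ℤ) * t + (7 : ℤ) * e) * φ (((137 : ℤ) : AdjoinRoot (csPoly 76))) = ((3 : ℤ) + (-7 : ℤ) * t + (21 : ℤ) * e) * (7 * ((6 : ℤ) + (-203 : ℤ) * t + (20 : ℤ) * e)) := by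
        rw [map_intCast]
        push_cast
        refine mul_left_cancel₀ (pow_ne_zero 2 h7) ?_
        linear_combination (-2940 * t ^ 2 + 227507 * t - 20580 * e - 14161) * he + (-2940 * t + 15827) * rel
      refine ⟨7 * a₀ * ((15 : ℤ) + (-19 : ℤ) * csRoot 76 + (3 : ℤ) * csRoot 76 ^ 2), a * ((11 : ℤ) + (-4 : ℤ) * csRoot 76 + (1 : ℤ) * csRoot 76 ^ 2),
          mul_ne_zero (mul_ne_zero h7A ha₀0) fun h => hX (by rw [← hx, h, map_zero]),
          mul_ne_zero ha0 fun h => hY (by rw [← hy, h, map_zero]), Or.inr (Or.inr (Or.inr (Or.inl ?_)))⟩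
      exact span_mul_eq_of_certificate_seventysix φ hφinj hN hmapJ ha ha₀ hx hy hdec
        (Ideal.mem_span_pair.mpr ⟨_, _, rfl⟩) (Ideal.mem_span_pair.mpr ⟨_, _, rfl⟩)
        (Ideal.mem_span_pair.mpr ⟨_, _, rfl⟩) (Ideal.mem_span_pair.mpr ⟨_, _, rfl⟩) e1 e2 e3 e4 hn1 hn2 f1 f2
    · -- the line `y = 5x`: the class of `⟨Θ - 65, 147⟩`
      -- certificate: X = (-t + 65), Y = (7 * e - 7); X · 7N = Y · φ(⟨Θ - 65, 147⟩)
      have hx : φ ((65 : ℤ) + (-1 : ℤ) * csRoot 76 + (0 : ℤ) * csRoot 76 ^ 2) = ((65 : ℤ) + (-1 : ℤ) * t + (0 : ℤ) * e) := by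
        rw [hφc]
        push_cast
        ring
      have hX : ((65 : ℤ) + (-1 : ℤ) * t + (0 : ℤ) * e) ≠ 0 := by
        push_cast
        refine ne_zero_of_mul_eq_natCast (7 * t - 7 * e + 644) 41601 ?_ (by norm_num)
        push_cast
        refine mul_left_cancel₀ (pow_ne_zero 1 h7) ?_
        linear_combination (7 * t - 455) * he + (7 : 𝓞 K) * rel
      have hy : φ ((-3 : ℤ) + (-4 : ℤ) * csRoot 76 + (1 : ℤ) * csRoot 76 ^ 2) = ((-7 : ℤ) + (0 : ℤ) * t + (7 : ℤ) * e) := by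
        rw [hφc]
        push_cast
        refine mul_left_cancel₀ (pow_ne_zero 1 h7) ?_
        linear_combination (-7) * he
      have hY : ((-7 : ℤ) + (0 : ℤ) * t + (7 : ℤ) * e) ≠ 0 := by
        push_cast
        refine ne_zero_of_mul_eq_natCast (15337 * t - 1470 * e - 31164) 97069 ?_ (by norm_num)
        push_cast
        refine mul_left_cancel₀ (pow_ne_zero 2 h7) ?_
        linear_combination (-10290 * t ^ 2 + 792673 * t - 72030 * e - 1496166) * he + (-10290 * t + 51793) * rel
      have hdec : ∀ n ∈ N, ∃ (r₁ r₂ : AdjoinRoot (csPoly 76)) (k₃ k₄ : ℤ),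
          n = φ r₁ * 7 + φ r₂ * (t - 2) + k₃ * ((1 : ℤ) + (0 : ℤ) * t + (6 : ℤ) * e) + k₄ * ((0 : ℤ) + (0 : ℤ) * t + (0 : ℤ) * e) := by
        intro n hn
        have hv := (hV _).mp ((hNV n).mp hn)
        dsimp only at hv
        obtain ⟨r₁, r₂, hr⟩ := hdec0 (n - ((ψ₁ n).val : ℤ) * ((1 : ℤ) + (0 : ℤ) * t + (6 : ℤ) * e))
          (by
            rw [map_sub, hψ₁k, hψ₁c]
            generalize ψ₁ n = u₁
            revert u₁
            decide)
          (by
            rw [map_sub, hψ₄k, hψ₄c, hv]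
            generalize ψ₁ n = u₁
            revert u₁
            decide)
        exact ⟨r₁, r₂, ((ψ₁ n).val : ℤ), 0, by rw [← hr]; push_cast; ring⟩
      have e1 : ((65 : ℤ) + (-1 : ℤ) * t + (0 : ℤ) * e) * (7 * (7 : 𝓞 K)) =
          ((-7 : ℤ) + (0 : ℤ) * t + (7 : ℤ) * e) * φ (((84 : ℤ) + (-7 : ℤ) * csRoot 76) * (csRoot 76 - ((65 : ℤ) : AdjoinRoot (csPoly 76))) + (30 : ℤ) * ((147 : ℤ) : AdjoinRoot (csPoly 76))) := by
        rw [hφb]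
        push_cast
        refine mul_left_cancel₀ (pow_ne_zero 1 h7) ?_
        linear_combination (49 * t ^ 2 - 3773 * t + 7350) * he + (49 * t - 245) * rel
      have e2 : ((65 : ℤ) + (-1 : ℤ) * t + (0 : ℤ) * e) * (7 * (t - 2)) =
          ((-7 : ℤ) + (0 : ℤ) * t + (7 : ℤ) * e) * φ (((-34 : ℤ) + (3 : ℤ) * csRoot 76) * (csRoot 76 - ((65 : ℤ) : AdjoinRoot (csPoly 76))) + (-13 : ℤ) * ((147 : ℤ) : AdjoinRoot (csPoly 76))) := by
        rw [hφb]
        push_cast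
        refine mul_left_cancel₀ (pow_ne_zero 1 h7) ?_
        linear_combination (-21 * t ^ 2 + 1603 * t - 2093) * he + (-21 * t + 91) * rel
      have e3 : ((65 : ℤ) + (-1 : ℤ) * t + (0 : ℤ) * e) * (7 * ((1 : ℤ) + (0 : ℤ) * t + (6 : ℤ) * e)) =
          ((-7 : ℤ) + (0 : ℤ) * t + (7 : ℤ) * e) * φ (((78 : ℤ) + (-7 : ℤ) * csRoot 76) * (csRoot 76 - ((65 : ℤ) : AdjoinRoot (csPoly 76))) + (30 : ℤ) * ((147 : ℤ) : AdjoinRoot (csPoly 76))) := by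
        rw [hφb]
        push_cast
        refine mul_left_cancel₀ (pow_ne_zero 1 h7) ?_
        linear_combination (49 * t ^ 2 - 3773 * t + 7350) * he + (49 * t - 245) * rel
      have e4 : ((65 : ℤ) + (-1 : ℤ) * t + (0 : ℤ) * e) * (7 * ((0 : ℤ) + (0 : ℤ) * t + (0 : ℤ) * e)) =
          ((-7 : ℤ) + (0 : ℤ) * t + (7 : ℤ) * e) * φ (((0 : ℤ) + (0 : ℤ) * csRoot 76) * (csRoot 76 - ((65 : ℤ) : AdjoinRoot (csPoly 76))) + (0 : ℤ) * ((147 : ℤ) : AdjoinRoot (csPoly 76))) := by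
        rw [hφb]
        push_cast
        ring
      have hn1 : ((1 : ℤ) + (0 : ℤ) * t + (-1 : ℤ) * e) ∈ N :=
        (hNV _).mpr ((hV _).mpr (by rw [hψ₁c, hψ₄c]; decide))
      have f1 : ((-7 : ℤ) + (0 : ℤ) * t + (7 : ℤ) * e) * φ (csRoot 76 - ((65 : ℤ) : AdjoinRoot (csPoly 76))) = ((65 : ℤ) + (-1 : ℤ) * t + (0 : ℤ) * e) * (7 * ((1 : ℤ) + (0 : ℤ) * t + (-1 : ℤ) * e)) := by
        rw [hφg]
        push_cast
        ring
      have hn2 : ((7 : ℤ) + (-7 : ℤ) * t + (-14 : ℤ) * e) ∈ N :=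
        (hNV _).mpr ((hV _).mpr (by rw [hψ₁c, hψ₄c]; decide))
      have f2 : ((-7 : ℤ) + (0 : ℤ) * t + (7 : ℤ) * e) * φ (((147 : ℤ) : AdjoinRoot (csPoly 76))) = ((65 : ℤ) + (-1 : ℤ) * t + (0 : ℤ) * e) * (7 * ((7 : ℤ) + (-7 : ℤ) * t + (-14 : ℤ) * e)) := by
        rw [map_intCast]
        push_cast
        refine mul_left_cancel₀ (pow_ne_zero 1 h7) ?_
        linear_combination (-98 * t + 7399) * he + (-98 : 𝓞 K) * rel
      refine ⟨7 * a₀ * ((65 : ℤ) + (-1 : ℤ) * csRoot 76 + (0 : ℤ) * csRoot 76 ^ 2), a * ((-3 : ℤ) + (-4 : ℤ) * csRoot 76 + (1 : ℤ) * csRoot 76 ^ 2),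
          mul_ne_zero (mul_ne_zero h7A ha₀0) fun h => hX (by rw [← hx, h, map_zero]),
          mul_ne_zero ha0 fun h => hY (by rw [← hy, h, map_zero]), Or.inr (Or.inr (Or.inr (Or.inr (Or.inl ?_))))⟩
      exact span_mul_eq_of_certificate_seventysix φ hφinj hN hmapJ ha ha₀ hx hy hdec
        (Ideal.mem_span_pair.mpr ⟨_, _, rfl⟩) (Ideal.mem_span_pair.mpr ⟨_, _, rfl⟩)
        (Ideal.mem_span_pair.mpr ⟨_, _, rfl⟩) (Ideal.mem_span_pair.mpr ⟨_, _, rfl⟩) e1 e2 e3 e4 hn1 hn2 f1 f2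
    · -- the line `y = 6x`: the class of `⟨Θ - 86, 147⟩`
      -- certificate: X = (7 * e), Y = (-7 * t + 14); X · 7N = Y · φ(⟨Θ - 86, 147⟩)
      have hx : φ ((4 : ℤ) + (-4 : ℤ) * csRoot 76 + (1 : ℤ) * csRoot 76 ^ 2) = ((0 : ℤ) + (0 : ℤ) * t + (7 : ℤ) * e) := by
        rw [hφc]
        push_cast
        refine mul_left_cancel₀ (pow_ne_zero 1 h7) ?_
        linear_combination (-7) * he
      have hX : ((0 : ℤ) + (0 : ℤ) * t + (7 : ℤ) * e) ≠ 0 := by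
        push_cast
        refine ne_zero_of_mul_eq_natCast (15337 * t - 1519 * e + 6125) 21609 ?_ (by norm_num)
        push_cast
        refine mul_left_cancel₀ (pow_ne_zero 2 h7) ?_
        linear_combination (-10633 * t ^ 2 + 794045 * t - 74431 * e + 257593) * he + (-10633 * t + 28469) * rel
      have hy : φ ((14 : ℤ) + (-7 : ℤ) * csRoot 76 + (0 : ℤ) * csRoot 76 ^ 2) = ((14 : ℤ) + (-7 : ℤ) * t + (0 : ℤ) * e) := by
        rw [hφc]
        push_cast
        ring
      have hY : ((14 : ℤ) + (-7 : ℤ) * t + (0 : ℤ) * e) ≠ 0 := by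
        push_cast
        refine ne_zero_of_mul_eq_natCast (3430 * t - 343 * e + 3773) 50421 ?_ (by norm_num)
        push_cast
        refine mul_left_cancel₀ (pow_ne_zero 1 h7) ?_
        linear_combination (2401 * t - 4802) * he + (2401 : 𝓞 K) * rel
      have hdec : ∀ n ∈ N, ∃ (r₁ r₂ : AdjoinRoot (csPoly 76)) (k₃ k₄ : ℤ),
          n = φ r₁ * 7 + φ r₂ * (t - 2) + k₃ * ((1 : ℤ) + (0 : ℤ) * t + (4 : ℤ) * e) + k₄ * ((0 : ℤ) + (0 : ℤ) * t + (0 : ℤ) * e) := by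
        intro n hn
        have hv := (hV _).mp ((hNV n).mp hn)
        dsimp only at hv
        obtain ⟨r₁, r₂, hr⟩ := hdec0 (n - ((ψ₁ n).val : ℤ) * ((1 : ℤ) + (0 : ℤ) * t + (4 : ℤ) * e))
          (by
            rw [map_sub, hψ₁k, hψ₁c]
            generalize ψ₁ n = u₁
            revert u₁
            decide)
          (by
            rw [map_sub, hψ₄k, hψ₄c, hv]
            generalize ψ₁ n = u₁
            revert u₁
            decide)
        exact ⟨r₁, r₂, ((ψ₁ n).val : ℤ), 0, by rw [← hr]; push_cast; ring⟩
      have e1 : ((0 : ℤ) + (0 : ℤ) * t + (7 : ℤ) * e) * (7 * (7 : 𝓞 K)) =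
          ((14 : ℤ) + (-7 : ℤ) * t + (0 : ℤ) * e) * φ (((-7 : ℤ) + (0 : ℤ) * csRoot 76) * (csRoot 76 - ((86 : ℤ) : AdjoinRoot (csPoly 76))) + (-4 : ℤ) * ((147 : ℤ) : AdjoinRoot (csPoly 76))) := by
        rw [hφb]
        push_cast
        refine mul_left_cancel₀ (pow_ne_zero 1 h7) ?_
        linear_combination (343) * he
      have e2 : ((0 : ℤ) + (0 : ℤ) * t + (7 : ℤ) * e) * (7 * (t - 2)) =
          ((14 : ℤ) + (-7 : ℤ) * t + (0 : ℤ) * e) * φ (((-82 : ℤ) + (-1 : ℤ) * csRoot 76) * (csRoot 76 - ((86 : ℤ) : AdjoinRoot (csPoly 76))) + (-48 : ℤ) * ((147 : ℤ) : AdjoinRoot (csPoly 76))) := by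
        rw [hφb]
        push_cast
        refine mul_left_cancel₀ (pow_ne_zero 1 h7) ?_
        linear_combination (49 * t - 98) * he
      have e3 : ((0 : ℤ) + (0 : ℤ) * t + (7 : ℤ) * e) * (7 * ((1 : ℤ) + (0 : ℤ) * t + (4 : ℤ) * e)) =
          ((14 : ℤ) + (-7 : ℤ) * t + (0 : ℤ) * e) * φ (((-3405 : ℤ) + (-40 : ℤ) * csRoot 76) * (csRoot 76 - ((86 : ℤ) : AdjoinRoot (csPoly 76))) + (-1992 : ℤ) * ((147 : ℤ) : AdjoinRoot (csPoly 76))) := by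
        rw [hφb]
        push_cast
        refine mul_left_cancel₀ (pow_ne_zero 2 h7) ?_
        linear_combination (196 * t ^ 2 - 784 * t + 1372 * e + 1127) * he + (196 * t - 392) * rel
      have e4 : ((0 : ℤ) + (0 : ℤ) * t + (7 : ℤ) * e) * (7 * ((0 : ℤ) + (0 : ℤ) * t + (0 : ℤ) * e)) =
          ((14 : ℤ) + (-7 : ℤ) * t + (0 : ℤ) * e) * φ (((0 : ℤ) + (0 : ℤ) * csRoot 76) * (csRoot 76 - ((86 : ℤ) : AdjoinRoot (csPoly 76))) + (0 : ℤ) * ((147 : ℤ) : AdjoinRoot (csPoly 76))) := by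
        rw [hφb]
        push_cast
        ring
      have hn1 : ((-45 : ℤ) + (-40 : ℤ) * t + (4 : ℤ) * e) ∈ N :=
        (hNV _).mpr ((hV _).mpr (by rw [hψ₁c, hψ₄c]; decide))
      have f1 : ((14 : ℤ) + (-7 : ℤ) * t + (0 : ℤ) * e) * φ (csRoot 76 - ((86 : ℤ) : AdjoinRoot (csPoly 76))) = ((0 : ℤ) + (0 : ℤ) * t + (7 : ℤ) * e) * (7 * ((-45 : ℤ) + (-40 : ℤ) * t + (4 : ℤ) * e)) := by
        rw [hφg]
        push_cast
        refine mul_left_cancel₀ (pow_ne_zero 2 h7) ?_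
        linear_combination (-196 * t ^ 2 + 14504 * t - 1372 * e + 14651) * he + (-196 * t + 392) * rel
      have hn2 : ((77 : ℤ) + (70 : ℤ) * t + (-7 : ℤ) * e) ∈ N :=
        (hNV _).mpr ((hV _).mpr (by rw [hψ₁c, hψ₄c]; decide))
      have f2 : ((14 : ℤ) + (-7 : ℤ) * t + (0 : ℤ) * e) * φ (((147 : ℤ) : AdjoinRoot (csPoly 76))) = ((0 : ℤ) + (0 : ℤ) * t + (7 : ℤ) * e) * (7 * ((77 : ℤ) + (70 : ℤ) * t + (-7 : ℤ) * e)) := by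
        rw [map_intCast]
        push_cast
        refine mul_left_cancel₀ (pow_ne_zero 2 h7) ?_
        linear_combination (343 * t ^ 2 - 25382 * t + 2401 * e - 25039) * he + (343 * t - 686) * rel
      refine ⟨7 * a₀ * ((4 : ℤ) + (-4 : ℤ) * csRoot 76 + (1 : ℤ) * csRoot 76 ^ 2), a * ((14 : ℤ) + (-7 : ℤ) * csRoot 76 + (0 : ℤ) * csRoot 76 ^ 2),
          mul_ne_zero (mul_ne_zero h7A ha₀0) fun h => hX (by rw [← hx, h, map_zero]),
          mul_ne_zero ha0 fun h => hY (by rw [← hy, h, map_zero]), Or.inr (Or.inr (Or.inr (Or.inr (Or.inr (Or.inl ?_)))))⟩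
      exact span_mul_eq_of_certificate_seventysix φ hφinj hN hmapJ ha ha₀ hx hy hdec
        (Ideal.mem_span_pair.mpr ⟨_, _, rfl⟩) (Ideal.mem_span_pair.mpr ⟨_, _, rfl⟩)
        (Ideal.mem_span_pair.mpr ⟨_, _, rfl⟩) (Ideal.mem_span_pair.mpr ⟨_, _, rfl⟩) e1 e2 e3 e4 hn1 hn2 f1 f2
  · -- `V = {x = 0}`: `N ⊆ ker ψ₁`, impossible
    exact absurd (fun n hn => (hV _).mp ((hNV n).mp hn)) (haxis ψ₁)

end Field

end Literature.Topology.FourManifolds
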